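import Literature.AlgebraicGeometry.Motives.CorrespondenceAlgebraModNumericalSemisimple
import Literature.AlgebraicGeometry.Motives.CorrespondenceCompositeTraceFormula
import Literature.AlgebraicGeometry.Motives.CorrespondencesConjectureDProofs
import HarnessLib

/-!
# Numerically trivial correspondences are the numerically trivial cycle classes
# (Jannsen 1992, Lemma 1 and Thm. 1; Kleiman 1968, §3.1), and `D(X × X) ⇒ Bⁿ(X × X)_K` semisimple

Topic `Literature/AlgebraicGeometry/Motives`, namespace
`Literature.AlgebraicGeometry.Motives.WeilCohomology`; sequel of
`Motives/CorrespondenceAlgebraModNumericalSemisimple` (the `K`-algebra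
`Bⁿ(X × X)_K = W.homCorrAlgebra n X` and its two-sided ideal `W.numericallyTrivial n X`, DEFINED
there through the trace side `Σ_i (-1)^i Tr_i(g ∘ f) = 0 ∀ g` of Jannsen's Lemma 1) and of
`Motives/CorrespondenceCompositeTraceFormula` (Lemma 1 itself,
`⟨u · ᵗw⟩ = Σ_i (-1)^i Tr_i(u_* ∘ w_*)`). This file closes the dictionary: the ideal is exactly the
set of operators whose classes are NUMERICALLY TRIVIAL in the sense of Kleiman 1968 §3.1 — the
tree's `W.IsNumericallyTrivial` for cycles and `W.StandardConjectureD`'s pairing condition for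
classes — so that the quotient `Bⁿ(X × X)_K ⧸ numericallyTrivial` of the previous file IS Jannsen's
`A = A^{dim X}_num(X × X)` (coefficients `K`).

Sources read on the page.
* U. Jannsen, *Motives, numerical equivalence, and semi-simplicity*, Invent. Math. **107** (1992)
  [Jannsen1992Motives] (held `paper:doi-10-1007-bf01231898`), p. 448: "**Lemma 1.** […]
  `⟨f · ᵗg⟩ = Σ_{i=0}^{2dim(X)} (-1)^i Tr_i(f ∘ g)` […] we conclude that `⟨f' · ᵗg⟩ = 0` for all
  `g ∈ B` by the lemma. By definition this means that `f'` lies in the kernel of `S`"; p. 447: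
  introduction "the category of motives […] is a semi-simple abelian category if - and in fact,
  only if - the relation is numerical equivalence"; p. 448: "Before Jannsen […] it was known that
  this statement followed from Grothendieck's standard conjectures" (Kahn 2020 p. 121).
* S. Kleiman, *Algebraic cycles and the Weil conjectures* (1968) [Kleiman1968AlgebraicCycles],
  §3.1 (`Z ∼_num 0`: intersection numbers with all cycles of complementary dimension vanish; the
  tree's `W.IsNumericallyTrivial`), §3 conjecture `D(X)` (the tree's `W.StandardConjectureD`).
* B. Kahn, *Zeta and L-functions of varieties and motives* (2020) [Kahn2020], §6.7 Prop. 6.21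
  (`A^d_H(X × X, K) → A^d_num(X × X, K)`).

## What is proved (theorems only; no definition, no named fact, no `sorry`)

For `X` smooth projective of dimension `n`:
* `mem_homCorrAlgebra_iff_exists_mem_algebraicClasses` — **`Bⁿ(X × X)_K` is exactly the set of
  degree-preserving operators induced by classes of the `K`-span `K · Aⁿ(X × X) ⊆ H²ⁿ(X × X)`**
  (`W.algebraicClasses (X ⊗ X) n`): Kahn's `A^n_H(X × X, K)`.
* **`mem_numericallyTrivial_iff_forall_trace_cup_eq_zero`** — for `f ∈ B` induced by `u`:
  `f` is numerically trivial ⟺ `tr_{X×X}(u ∪ v) = 0` for every `v ∈ Aⁿ(X × X)_ℚ` (Lemma 1 with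
  `ᵗᵗv = v`, transposition preserving algebraicity);
* **`mem_numericallyTrivial_iff_forall_cycleMap`** — ⟺ `tr_{X×X}(u ∪ γ(Z)) = 0` for every
  codimension-`n` CYCLE `Z` on `X × X` (Kleiman §3.1; `Aⁿ = γ(Zⁿ)`);
* **`mem_numericallyTrivial_iff_isNumericallyTrivial`** — for the operator of the class `γ(Z)` of
  a codimension-`n` cycle `Z` on `X × X`: numerically trivial as a correspondence ⟺
  `W.IsNumericallyTrivial (n + n) (X ⊗ X) n Z`, the tree's numerical triviality of the cycle;
* `numericallyTrivial_eq_bot_of_pairing`, **`isSemisimpleRing_homCorrAlgebra_of_pairing`** — if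
  the pairing `K · Aⁿ(X × X) × Aⁿ(X × X)_ℚ → K` has trivial left kernel (homological = numerical
  equivalence on `Bⁿ(X × X)_K`; `D(X × X)` in degree `n` for `K`-linear combinations) then the
  numerically trivial ideal vanishes and `Bⁿ(X × X)_K` is SEMISIMPLE ("it was known that this
  statement followed from Grothendieck's standard conjectures");
* `eq_zero_of_isHomCorrespondence_of_mem_numericallyTrivial_of_standardConjectureD` — from the
  tree's `W.StandardConjectureD (n + n) (X ⊗ X)` (trivial left kernel on `ℚ`-classes): under
  `D(X × X)` no non-zero homological correspondence WITH `ℚ`-COEFFICIENTS is numerically trivial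
  (the passage from `ℚ`- to `K`-coefficients in the hypothesis, Kahn 2020 Thm. 6.4 (2), is a
  sequel); `exists_cycle_isInducedBy_zsmul` (every generator is, up to `N ≠ 0`, the operator of an
  actual cycle).

## References

* [Jannsen1992Motives] U. Jannsen, Invent. Math. 107 (1992) 447–452 — Lemma 1, Thm. 1 (p. 448).
* [Kleiman1968AlgebraicCycles] S. Kleiman, *Algebraic cycles and the Weil conjectures* (1968) —
  §3.1, §3 `D(X)`, Prop. 1.3.6.
* [Kahn2020] B. Kahn, *Zeta and L-functions of varieties and motives* (2020) — §6.7 Prop. 6.21,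
  §6.2 Thm. 6.4.

## Provenance

Lane `lit-hodgefound` (summit `HodgeConjecture`, Track 2 foundations library, Layer B: motives),
seat `lit-hodgefound-p29` (literature-prover, generation 34, row g34-#4).
-/

universe u v

open CategoryTheory AlgebraicGeometry MonoidalCategory CartesianMonoidalCategory
open scoped TensorProduct

noncomputable section

namespace Literature.AlgebraicGeometry.Motives

namespace WeilCohomology

variable {k : Type u} [Field k] {K : Type v} [Field K] [CharZero K] (W : WeilCohomology k K)
variable {n : ℕ} {X : SchemeOver k}

/-! ## `Bⁿ(X × X)_K` = operators of the `K`-span of the algebraic classes -/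

section Span

/-- The operator `u_* = (W.corrOp hX n n u i i)_i` of a rational algebraic class
`u ∈ Aⁿ(X × X)_ℚ` is a homological correspondence. [cite: Kleiman1968AlgebraicCycles, §1.3] -/
theorem isHomCorrespondence_corrOp (hX : IsSmoothProjective n X) {u : W.obj (X ⊗ X) (2 * n)}
    (hu : u ∈ W.ratAlgebraicClasses (X ⊗ X) n) :
    W.IsHomCorrespondence n X (fun i ↦ W.corrOp hX n n u i i) :=
  ⟨u, hu, fun i j' h ↦ W.isInducedBy_corrOp hX (nX := n) (c := n) (i := i) (j := i) (by omega) h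
    (show i + 2 * n + j' = 2 * (n + n) by omega) u⟩

/-- The operator of any class of the `K`-span `K · Aⁿ(X × X)` lies in `Bⁿ(X × X)_K` (span
induction: the operator is `K`-linear in the class). [cite: Kahn2020, §6.7 Prop. 6.21 (proof)] -/
theorem corrOp_mem_homCorrAlgebra (hX : IsSmoothProjective n X) {u : W.obj (X ⊗ X) (2 * n)}
    (hu : u ∈ W.algebraicClasses (X ⊗ X) n) :
    (fun i ↦ W.corrOp hX n n u i i) ∈ W.homCorrAlgebra n X := by
  induction hu using Submodule.span_induction with
  | mem x hx =>
    exact (W.isHomCorrespondence_corrOp hX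
      (W.algebraicLattice_le_ratAlgebraicClasses (X ⊗ X) n hx)).mem_homCorrAlgebra
  | zero =>
    have : (fun i ↦ W.corrOp hX n n (0 : W.obj (X ⊗ X) (2 * n)) i i) =
        (0 : Π i : ℕ, Module.End K (W.obj X i)) := by
      funext i; simp
    rw [this]; exact zero_mem _
  | add x y _ _ hx hy =>
    have : (fun i ↦ W.corrOp hX n n (x + y) i i) =
        (fun i ↦ W.corrOp hX n n x i i) + (fun i ↦ W.corrOp hX n n y i i) := by
      funext i; simp
    rw [this]; exact add_mem hx hy
  | smul c x _ hx =>
    have : (fun i ↦ W.corrOp hX n n (c • x) i i) = c • (fun i ↦ W.corrOp hX n n x i i) := by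
      funext i; simp
    rw [this]; exact Subalgebra.smul_mem _ hx c

/-- **`Bⁿ(X × X)_K` is the set of degree-preserving operators induced by the classes of the
`K`-span `K · Aⁿ(X × X) ⊆ H²ⁿ(X × X)`** (`W.algebraicClasses (X ⊗ X) n`) — Kahn's
`A^n_H(X × X, K)` "injects into `End_K(H^*(X))` via the cycle class homomorphism": (⇒) span
induction from the generators (`homCorrAlgebra_induction`, `IsInducedBy.add/smul`); (⇐) the
operator of a `K`-combination of algebraic classes is the `K`-combination of their operators.
[cite: Kahn2020, §6.7 Prop. 6.21 (proof)] [cite: Jannsen1992Motives, p. 450] -/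
theorem mem_homCorrAlgebra_iff_exists_mem_algebraicClasses (hX : IsSmoothProjective n X)
    (f : Π i : ℕ, Module.End K (W.obj X i)) :
    f ∈ W.homCorrAlgebra n X ↔ ∃ u ∈ W.algebraicClasses (X ⊗ X) n,
      ∀ (i j' : ℕ) (h : i + j' = 2 * n),
        W.IsInducedBy n n u (f i) h (show i + 2 * n + j' = 2 * (n + n) by omega) := by
  constructor
  · intro hf
    refine W.homCorrAlgebra_induction hX (p := fun f ↦ ∃ u ∈ W.algebraicClasses (X ⊗ X) n,
      ∀ (i j' : ℕ) (h : i + j' = 2 * n),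
        W.IsInducedBy n n u (f i) h (show i + 2 * n + j' = 2 * (n + n) by omega)) ?_ ?_ ?_ ?_ hf
    · rintro T ⟨u, hu, hT⟩
      exact ⟨u, W.ratAlgebraicClasses_le_algebraicClasses (X ⊗ X) n hu, hT⟩
    · exact ⟨0, zero_mem _, fun i j' h ↦ W.isInducedBy_zero⟩
    · rintro S T ⟨u, hu, hS⟩ ⟨v, hv, hT⟩
      exact ⟨u + v, add_mem hu hv, fun i j' h ↦ (hS i j' h).add (hT i j' h)⟩
    · rintro c T ⟨u, hu, hT⟩
      exact ⟨c • u, Submodule.smul_mem _ c hu, fun i j' h ↦ (hT i j' h).smul c⟩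
  · rintro ⟨u, hu, hf⟩
    have e : f = fun i ↦ W.corrOp hX n n u i i :=
      W.eq_of_forall_isInducedBy hX hf fun i j' h ↦
        W.isInducedBy_corrOp hX (nX := n) (c := n) (i := i) (j := i) (by omega) h
          (show i + 2 * n + j' = 2 * (n + n) by omega) u
    rw [e]
    exact W.corrOp_mem_homCorrAlgebra hX hu

/-- Every element of `Bⁿ(X × X)_K` is induced by a class of `K · Aⁿ(X × X)`.
[cite: Kahn2020, §6.7 Prop. 6.21 (proof)] -/
theorem exists_mem_algebraicClasses_isInducedBy (hX : IsSmoothProjective n X)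
    (f : W.homCorrAlgebra n X) :
    ∃ u ∈ W.algebraicClasses (X ⊗ X) n, ∀ (i j' : ℕ) (h : i + j' = 2 * n),
      W.IsInducedBy n n u ((f : Π i : ℕ, Module.End K (W.obj X i)) i) h
        (show i + 2 * n + j' = 2 * (n + n) by omega) :=
  (W.mem_homCorrAlgebra_iff_exists_mem_algebraicClasses hX _).mp f.2

end Span

/-! ## The numerically trivial ideal through intersection numbers -/

section Bridge

/-- The graded trace of a product `f ∘ g` in `Π_i End_K Hⁱ(X)` is Jannsen's `Σ_i (-1)^i Tr_i(f ∘ g)`;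
by Lemma 1, for `f`, `g` induced by `u`, `w`, it is `tr_{X×X}(u ∪ ᵗw)`.
[cite: Jannsen1992Motives, Lemma 1] -/
theorem gradedTrace_mul_eq_trace_cup_transposeClass (hX : IsSmoothProjective n X)
    {f g : Π i : ℕ, Module.End K (W.obj X i)} {u w : W.obj (X ⊗ X) (2 * n)}
    (hf : ∀ (i j' : ℕ) (h : i + j' = 2 * n),
      W.IsInducedBy n n u (f i) h (show i + 2 * n + j' = 2 * (n + n) by omega))
    (hg : ∀ (i j' : ℕ) (h : i + j' = 2 * n),
      W.IsInducedBy n n w (g i) h (show i + 2 * n + j' = 2 * (n + n) by omega))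
    (H : 2 * n + 2 * n = 2 * (n + n)) :
    W.gradedTrace n X (f * g) = W.trace (X ⊗ X) (n + n) (W.cup H u (W.transposeClass w)) := by
  rw [gradedTrace_apply, W.trace_cup_transposeClass_eq_sum_trace_comp_of_isInducedBy hX f g hf hg H]
  rfl

/-- **The numerically trivial ideal through intersection numbers** (Jannsen: "`⟨f' · ᵗg⟩ = 0` for
all `g ∈ B` by the lemma. By definition this means that `f'` lies in the kernel of `S`"): for
`f ∈ Bⁿ(X × X)_K` induced by the class `u ∈ H²ⁿ(X × X)`, `f` is numerically trivial
(`Σ_i (-1)^i Tr_i(g ∘ f) = 0` for all `g ∈ B`) iff `tr_{X×X}(u ∪ v) = 0` for every rational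
algebraic class `v ∈ Aⁿ(X × X)_ℚ` — Lemma 1 with `ᵗᵗv = v`, transposes of algebraic classes being
algebraic. [cite: Jannsen1992Motives, Lemma 1 and proof of Thm. 1] [cite: Kleiman1968AlgebraicCycles, §3.1] -/
theorem mem_numericallyTrivial_iff_forall_trace_cup_eq_zero (hX : IsSmoothProjective n X)
    {f : W.homCorrAlgebra n X} {u : W.obj (X ⊗ X) (2 * n)}
    (hf : ∀ (i j' : ℕ) (h : i + j' = 2 * n),
      W.IsInducedBy n n u ((f : Π i : ℕ, Module.End K (W.obj X i)) i) h
        (show i + 2 * n + j' = 2 * (n + n) by omega))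
    (H : 2 * n + 2 * n = 2 * (n + n)) :
    f ∈ W.numericallyTrivial n X ↔
      ∀ v ∈ W.ratAlgebraicClasses (X ⊗ X) n, W.trace (X ⊗ X) (n + n) (W.cup H u v) = 0 := by
  constructor
  · intro hfN v hv
    have hg : W.IsHomCorrespondence n X (fun i ↦ W.corrOp hX n n (W.transposeClass v) i i) :=
      W.isHomCorrespondence_corrOp hX (W.transposeClass_mem_ratAlgebraicClasses hX hX hv)
    have h := (W.mem_numericallyTrivial_iff_right.mp hfN) ⟨_, hg.mem_homCorrAlgebra⟩
    rw [Subalgebra.coe_mul] at h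
    rw [W.trace_cup_eq_sum_trace_comp_of_isInducedBy_transposeClass hX
        (fun i ↦ (f : Π i : ℕ, Module.End K (W.obj X i)) i)
        (fun i ↦ W.corrOp hX n n (W.transposeClass v) i i) hf
        (fun i j' h' ↦ W.isInducedBy_corrOp hX (nX := n) (c := n) (i := i) (j := i) (by omega) h'
          (show i + 2 * n + j' = 2 * (n + n) by omega) _) H,
      ← gradedTrace_apply]
    exact h
  · intro hperp
    rw [W.mem_numericallyTrivial_iff_forall_isHomCorrespondence hX]
    rintro g ⟨w, hw, hg⟩
    rw [W.gradedTrace_mul_comm, W.gradedTrace_mul_eq_trace_cup_transposeClass hX hf hg H]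
    exact hperp _ (W.transposeClass_mem_ratAlgebraicClasses hX hX hw)

/-- **… through cycles** (Kleiman 1968 §3.1: `Z ∼_num 0` iff its intersection numbers with all cycles
of complementary dimension vanish): for `f ∈ Bⁿ(X × X)_K` induced by `u`, `f` is numerically trivial
iff `tr_{X×X}(u ∪ γ(Z)) = 0` for every codimension-`n` cycle `Z` on `X × X` (the lattice
`Aⁿ(X × X)` consists of cycle classes, `exists_cycleMap_eq_of_mem_algebraicLattice`, and the pairing
with its divisible hull vanishes as soon as it vanishes on the lattice, `char K = 0`).
[cite: Kleiman1968AlgebraicCycles, §3.1] [cite: Jannsen1992Motives, Lemma 1 and proof of Thm. 1] -/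
theorem mem_numericallyTrivial_iff_forall_cycleMap (hX : IsSmoothProjective n X)
    {f : W.homCorrAlgebra n X} {u : W.obj (X ⊗ X) (2 * n)}
    (hf : ∀ (i j' : ℕ) (h : i + j' = 2 * n),
      W.IsInducedBy n n u ((f : Π i : ℕ, Module.End K (W.obj X i)) i) h
        (show i + 2 * n + j' = 2 * (n + n) by omega))
    (H : 2 * n + 2 * n = 2 * (n + n)) :
    f ∈ W.numericallyTrivial n X ↔ ∀ Z ∈ cyclesOfCodim (X ⊗ X).left n,
      W.trace (X ⊗ X) (n + n) (W.cup H u (W.cycleMap (X ⊗ X) n Z)) = 0 := by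
  haveI : CompactSpace (X ⊗ X).left :=
    IsSmoothProjective.compactSpace_holds (isSmoothProjective_tensor hX hX)
  rw [W.mem_numericallyTrivial_iff_forall_trace_cup_eq_zero hX hf H]
  constructor
  · intro h Z hZ
    exact h _ (W.algebraicLattice_le_ratAlgebraicClasses (X ⊗ X) n
      (W.cycleMap_mem_algebraicLattice (X ⊗ X) n hZ))
  · intro h v hv
    have h' := W.cupPairing_eq_zero_of_mem_ratAlgebraicClasses (X ⊗ X) (n + n) (2 * n) n H u
      (fun z hz ↦ ?_) hv
    · simpa only [cupPairing_apply] using h'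
    · obtain ⟨Z, hZ, rfl⟩ := W.exists_cycleMap_eq_of_mem_algebraicLattice (X ⊗ X) n hz
      rw [cupPairing_apply]
      exact h Z hZ

/-- **The operator of a cycle is numerically trivial iff the cycle is** (Kleiman 1968 §3.1; the
tree's `W.IsNumericallyTrivial`): for a codimension-`n` cycle `Z` on `X × X` and `f ∈ Bⁿ(X × X)_K`
induced by its class `γ(Z)`, `f` is numerically trivial as a correspondence iff
`W.IsNumericallyTrivial (n + n) (X ⊗ X) n Z`. So `Bⁿ(X × X)_K ⧸ numericallyTrivial` is the ring of
homological correspondences of degree `0` modulo numerical equivalence, Jannsen's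
`A^{dim X}_num(X × X)` with coefficients `K`. [cite: Kleiman1968AlgebraicCycles, §3.1]
[cite: Jannsen1992Motives, Thm. 1] -/
theorem mem_numericallyTrivial_iff_isNumericallyTrivial (hX : IsSmoothProjective n X)
    {f : W.homCorrAlgebra n X} {Z : AlgebraicCycle (X ⊗ X).left ℤ}
    (hf : ∀ (i j' : ℕ) (h : i + j' = 2 * n),
      W.IsInducedBy n n (W.cycleMap (X ⊗ X) n Z) ((f : Π i : ℕ, Module.End K (W.obj X i)) i) h
        (show i + 2 * n + j' = 2 * (n + n) by omega)) :
    f ∈ W.numericallyTrivial n X ↔ W.IsNumericallyTrivial (n + n) (X ⊗ X) n Z := by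
  have H : 2 * n + 2 * n = 2 * (n + n) := by omega
  rw [W.mem_numericallyTrivial_iff_forall_cycleMap hX hf H]
  constructor
  · intro h q hq Z' hZ'
    obtain rfl : q = n := by omega
    rw [cupPairing_apply]
    exact h Z' hZ'
  · intro h Z' hZ'
    have := h n rfl Z' hZ'
    rwa [cupPairing_apply] at this

/-- A homological correspondence (with `ℚ`-coefficients) is the operator of the class of an actual
cycle, up to a non-zero integer: for `f ∈ Bⁿ(X × X)_K` induced by `u ∈ Aⁿ(X × X)_ℚ` there are
`N ≠ 0` and a codimension-`n` cycle `Z` on `X × X` with `γ(Z) = N • u`, so that `N • f` is induced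
by `γ(Z)` (`Aⁿ(X × X)_ℚ` is the divisible hull of `γ(Zⁿ(X × X))`). [cite: Kleiman1968AlgebraicCycles, §1.4 and §3.1] -/
theorem exists_cycle_isInducedBy_zsmul (hX : IsSmoothProjective n X)
    {f : Π i : ℕ, Module.End K (W.obj X i)} {u : W.obj (X ⊗ X) (2 * n)}
    (hu : u ∈ W.ratAlgebraicClasses (X ⊗ X) n)
    (hf : ∀ (i j' : ℕ) (h : i + j' = 2 * n),
      W.IsInducedBy n n u (f i) h (show i + 2 * n + j' = 2 * (n + n) by omega)) :
    ∃ (N : ℤ) (Z : AlgebraicCycle (X ⊗ X).left ℤ), N ≠ 0 ∧ Z ∈ cyclesOfCodim (X ⊗ X).left n ∧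
      W.cycleMap (X ⊗ X) n Z = N • u ∧
      ∀ (i j' : ℕ) (h : i + j' = 2 * n),
        W.IsInducedBy n n (W.cycleMap (X ⊗ X) n Z) ((N • f) i) h
          (show i + 2 * n + j' = 2 * (n + n) by omega) := by
  haveI : CompactSpace (X ⊗ X).left :=
    IsSmoothProjective.compactSpace_holds (isSmoothProjective_tensor hX hX)
  obtain ⟨N, hN, hNu⟩ := hu
  obtain ⟨Z, hZ, hZu⟩ := W.exists_cycleMap_eq_of_mem_algebraicLattice (X ⊗ X) n hNu
  refine ⟨N, Z, hN, hZ, hZu, fun i j' h ↦ ?_⟩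
  rw [hZu, Pi.smul_apply, ← Int.cast_smul_eq_zsmul K, ← Int.cast_smul_eq_zsmul K]
  exact (hf i j' h).smul (N : K)

end Bridge

/-! ## Homological = numerical on `Bⁿ(X × X)_K` makes it semisimple -/

section Semisimple

/-- **If the intersection pairing `K · Aⁿ(X × X) × Aⁿ(X × X)_ℚ → K` has trivial left kernel**
(homological equivalence = numerical equivalence for the `K`-linear homological correspondences of
degree `0`; conjecture `D(X × X)` in degree `n` for `K`-coefficients) **then no non-zero element of
`Bⁿ(X × X)_K` is numerically trivial.** [cite: Jannsen1992Motives, Thm. 1] [cite: Kleiman1968AlgebraicCycles, §3 D(X)] -/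
theorem numericallyTrivial_eq_bot_of_pairing (hX : IsSmoothProjective n X) (H : 2 * n + 2 * n = 2 * (n + n))
    (hD : ∀ u ∈ W.algebraicClasses (X ⊗ X) n,
      (∀ v ∈ W.ratAlgebraicClasses (X ⊗ X) n, W.trace (X ⊗ X) (n + n) (W.cup H u v) = 0) → u = 0) :
    W.numericallyTrivial n X = ⊥ := by
  refine le_bot_iff.mp fun f hf ↦ ?_
  obtain ⟨u, hu, hfu⟩ := W.exists_mem_algebraicClasses_isInducedBy hX f
  have hu0 : u = 0 := hD u hu ((W.mem_numericallyTrivial_iff_forall_trace_cup_eq_zero hX hfu H).mp hf)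
  subst hu0
  have hf0 : (f : Π i : ℕ, Module.End K (W.obj X i)) = 0 :=
    W.eq_of_forall_isInducedBy hX hfu fun i j' h ↦ W.isInducedBy_zero
  change f ∈ (⊥ : TwoSidedIdeal (W.homCorrAlgebra n X))
  rw [TwoSidedIdeal.mem_bot]
  exact Subtype.ext hf0

/-- **`D(X × X)` (for `K`-linear combinations, degree `n`) ⇒ `Bⁿ(X × X)_K` is semisimple** — the
classical conditional route to semisimplicity ("it was known that this statement followed from
Grothendieck's standard conjectures": with hom = num the algebra `B = A` is semisimple by
Theorem 1). [cite: Jannsen1992Motives, Thm. 1] [cite: Kahn2020, §6.7 (p. 121)] -/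
theorem isSemisimpleRing_homCorrAlgebra_of_pairing (hX : IsSmoothProjective n X)
    (H : 2 * n + 2 * n = 2 * (n + n))
    (hD : ∀ u ∈ W.algebraicClasses (X ⊗ X) n,
      (∀ v ∈ W.ratAlgebraicClasses (X ⊗ X) n, W.trace (X ⊗ X) (n + n) (W.cup H u v) = 0) → u = 0) :
    IsSemisimpleRing (W.homCorrAlgebra n X) :=
  W.isSemisimpleRing_homCorrAlgebra_of_numericallyTrivial_eq_bot hX
    (W.numericallyTrivial_eq_bot_of_pairing hX H hD)

/-- **Under the tree's `D(X × X)` (trivial left kernel on `ℚ`-classes), no non-zero homological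
correspondence WITH `ℚ`-COEFFICIENTS is numerically trivial**: a generator `f` of `Bⁿ(X × X)_K`
(induced by `u ∈ Aⁿ(X × X)_ℚ`) lying in the numerically trivial ideal is `0`.
[cite: Jannsen1992Motives, Thm. 1] [cite: Kleiman1968AlgebraicCycles, §3 D(X)] -/
theorem eq_zero_of_isHomCorrespondence_of_mem_numericallyTrivial_of_standardConjectureD
    (hX : IsSmoothProjective n X) (hD : W.StandardConjectureD (n + n) (X ⊗ X))
    {f : W.homCorrAlgebra n X}
    (hf : W.IsHomCorrespondence n X (f : Π i : ℕ, Module.End K (W.obj X i)))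
    (hfN : f ∈ W.numericallyTrivial n X) : f = 0 := by
  have H : 2 * n + 2 * n = 2 * (n + n) := by omega
  obtain ⟨u, hu, hfu⟩ := hf
  have hperp := (W.mem_numericallyTrivial_iff_forall_trace_cup_eq_zero hX hfu H).mp hfN
  have hu0 : u = 0 := hD n n rfl u hu fun v hv ↦ by
    rw [cupPairing_apply]
    exact hperp v hv
  subst hu0
  exact Subtype.ext (W.eq_of_forall_isInducedBy hX hfu fun i j' h ↦ W.isInducedBy_zero)

end Semisimple

end WeilCohomology

end Literature.AlgebraicGeometry.Motives

end
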